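import Literature.AlgebraicGeometry.HodgeTheory.FermatShiodaCondition
import HarnessLib

/-!
# Transfer of Hodge multisets from level `ℓn` to level `n` for a prime `ℓ` NOT dividing `n` (Aoki's `τ_ℓ`)

Topic `Literature/AlgebraicGeometry/HodgeTheory`. THEOREMS only (no definition, no named fact, no `sorry`). Companion of
`FermatHodgeMultisetTransfer` (`T₂`, `T₃`, `T_ℓ` for `ℓ² ∣ m`): the level-lowering map at a prime `ℓ` dividing the level EXACTLY
ONCE. For Shioda's Hodge multisets (`FermatCharacter.IsHodgeMultiset`: non-zero residues mod `m` with sum `0` and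
`2 Σ ⟨t a⟩ = m · #s` for every unit `t`, [Shioda1979PJA, §1 (2), (3)]) over `ℤ/ℓn` with `ℓ` prime, `(ℓ, n) = 1`:

* **`isHodgeMultiset_transfer_single`**: split `s` into its members `w` with `ℓ ∤ ⟨w⟩`, `n ∤ ⟨w⟩` (`s₁`), with `ℓ ∤ ⟨w⟩`,
  `n ∣ ⟨w⟩` (`s₂`, the non-zero multiples of `n`) and with `ℓ ∣ ⟨w⟩` (`s₀`). If `s₁ + s₂ + s₀` is a Hodge multiset of level
  `ℓn`, then
  `τ_ℓ(s) = (s₁ mod n) + (−ℓ⁻¹ · s₁ mod n) + (ℓ − 1)·((representatives of s₀)/ℓ, read mod n)`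
  is a Hodge multiset of level `n`: every member prime to `ℓ` is replaced by the TWO residues `w̄`, `−ℓ⁻¹ w̄` of level `n`
  (`ℓ⁻¹` the inverse of `ℓ` modulo `n`), every multiple `ℓ w₁` of `ℓ` by `ℓ − 1` copies of `w̄₁`, and the multiples of `n`
  disappear.

This is the multiset shadow of Aoki's map `τ_d : R_m → R_{m/d}` [Aoki1983, p. 28]
("`τ_d(a) = (φ(m)/φ(m′)) ∏_{p ∣ d/(m,a), p ∤ m/d} (1, −p⁻¹)(a′)` if `(m, a) ∣ d`") at `d = ℓ` with `ℓ ∥ m`: a member `a` prime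
to `ℓ` goes to `(1, −ℓ⁻¹)(ā) = (ā) + (−ℓ⁻¹ā)`, a multiple of `ℓ` (`(m, a) ⊇ ℓ`, `φ(m)/φ(m′) ∋` the factor `φ(ℓ) = ℓ − 1`) to
`ℓ − 1` copies, and [Aoki1983, Prop. 2.2] ("`α ∈ B_m` iff `τ_d(α) ∈ A(m/d)` for all `d ∣ m`") — here in the self-contained form
"`s ∈ B⁺_{ℓn} ⟹ τ_ℓ(s) ∈ B⁺_n`", proved directly on Shioda's norm equations. It is the tool by which a member divisible by `ℓ`
(invisible to the unit relations of level `ℓn`) becomes `ℓ − 1` copies of a residue prime to `ℓ` one level down (cell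
`pub-hfermat`, LIT lane: the levels `2ᵃ3ᵇ·5`, `2ᵃ3ᵇ·7`, `2ᵃ3ᵇ·35` of [Aoki1983, Thm. C], where `5, 7` divide the level once).

PROOF. Fix a unit `v` of `ℤ/n` and a unit `u` of `ℤ/ℓn` above it. The `ℓ` elements `e_j = 1 + j n` (`j mod ℓ`) reduce to `1`
modulo `n`; modulo `ℓ` they run through all residues (`n` is invertible mod `ℓ`), so exactly one of them, `e_{j₀}`, is
divisible by `ℓ` and the other `ℓ − 1` are units of `ℤ/ℓn`. For a member `w` with `ℓ ∤ ⟨w⟩` the products `u e_j w = uw + j⟨uw⟩n`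
run through `uw + k n`, `k mod ℓ`, and `Σ_k ⟨uw + kn⟩ = ℓ(⟨uw⟩ mod n) + n·ℓ(ℓ−1)/2`; the excluded product `u e_{j₀} w` is the
multiple of `ℓ` congruent to `uw` modulo `n`, i.e. `ℓ·⟨ℓ⁻¹ v w̄⟩`. For a member `w = ℓ w₁` all products equal `uw = ℓ·(u w₁)`,
`⟨uw⟩ = ℓ⟨v w̄₁⟩`. Adding the `ℓ − 1` norm equations `2 Σ_w ⟨u e_j w⟩ = ℓ n #s` (`j ≠ j₀`) and dividing by `ℓ` gives
`2 Σ_{s₁} (⟨v w̄⟩ − ⟨ℓ⁻¹ v w̄⟩) + 2(ℓ − 1) Σ_{s₀} ⟨v w̄₁⟩ = (ℓ − 1) n #s₀`, which with `⟨−x⟩ = n − ⟨x⟩` is the norm equation of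
`τ_ℓ(s)` at `v`.

Cross-checks outside Lean (cell `pub-hfermat`, `pub-hfermat-lit` g40 `num/relsim2.py`): `τ₅` of every Hodge `4`-multiset of the
levels `240, 640, 720` and `τ₇` at `448` is a Hodge multiset of the lower level (`0` failures); pulled back along `τ₅`, `τ₇`, `τ₃`
the unit relations of the lower levels kill the non-Hodge `4`-configurations with a member divisible by `5`, `7`, `3` that no
relation of the upper level sees.

HONEST FRAMING (cell `pub-hfermat`): explicit algebraic cycles for specific Hodge classes on Fermat/Delsarte varieties; residual open
instances listed; no claim on general Hodge. (An elementary identity about Shioda's Hodge condition; no cycle is constructed here.)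

## References
* [Aoki1983] N. Aoki, *On some arithmetic problems related to the Hodge cycles on the Fermat varieties*, Math. Ann. 266 (1983) 23–54,
  p. 28 (the maps `τ_d`), Prop. 2.2 p. 29 (level change).
* [Shioda1979PJA] T. Shioda, *The Hodge conjecture and the Tate conjecture for Fermat varieties*, Proc. Japan Acad. 55A (1979)
  111–114, §1 eqs. (2), (3).
-/

namespace Literature.AlgebraicGeometry.HodgeTheory

namespace FermatCharacter

open Multiset

variable {n ℓ : ℕ}

/-! ### Arithmetic of representatives at the levels `ℓn` and `n` (`ℓ` prime to `n`) -/

section SingleTransfer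

/-- `ℓ·n = 0` at level `ℓn`. [folklore] -/
private theorem ell_mul_n : (ℓ : ZMod (ℓ * n)) * (n : ZMod (ℓ * n)) = 0 := by
  rw [← Nat.cast_mul, ZMod.natCast_self]

/-- `n · x = (⟨x⟩ mod ℓ) · n` at level `ℓn`. [folklore] -/
private theorem n_mul [NeZero n] (hℓ : 0 < ℓ) (x : ZMod (ℓ * n)) :
    (n : ZMod (ℓ * n)) * x = ((x.val % ℓ : ℕ) : ZMod (ℓ * n)) * (n : ZMod (ℓ * n)) := by
  haveI : NeZero (ℓ * n) := ⟨Nat.pos_iff_ne_zero.mp (Nat.mul_pos hℓ (NeZero.pos n))⟩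
  have e : x = ((x.val : ℕ) : ZMod (ℓ * n)) := (ZMod.natCast_zmod_val x).symm
  have hd := Nat.div_add_mod x.val ℓ
  have h3 := ell_mul_n (ℓ := ℓ) (n := n)
  conv_lhs => rw [e, ← hd]
  push_cast
  linear_combination (↑(x.val / ℓ) : ZMod (ℓ * n)) * h3

/-- `(j mod ℓ) · n = j · n` at level `ℓn`. [folklore] -/
private theorem natCast_mod_mul_n (j : ℕ) :
    (((j % ℓ : ℕ)) : ZMod (ℓ * n)) * (n : ZMod (ℓ * n)) = (j : ZMod (ℓ * n)) * (n : ZMod (ℓ * n)) := by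
  have hd := Nat.div_add_mod j ℓ
  have h3 := ell_mul_n (ℓ := ℓ) (n := n)
  conv_rhs => rw [← hd]
  push_cast
  linear_combination -(↑(j / ℓ) : ZMod (ℓ * n)) * h3

/-- **`⟨y + j·n⟩ = (⟨y⟩ mod n) + ((⟨y⟩ div n + j) mod ℓ)·n`** at level `ℓn`. [folklore] -/
private theorem val_add_mul_n [NeZero n] (hℓ : 0 < ℓ) (y : ZMod (ℓ * n)) (j : ℕ) :
    (y + (j : ZMod (ℓ * n)) * (n : ZMod (ℓ * n))).val = y.val % n + ((y.val / n + j) % ℓ) * n := by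
  haveI : NeZero (ℓ * n) := ⟨Nat.pos_iff_ne_zero.mp (Nat.mul_pos hℓ (NeZero.pos n))⟩
  have hn := NeZero.pos n
  have e : y + (j : ZMod (ℓ * n)) * (n : ZMod (ℓ * n)) = ((y.val + j * n : ℕ) : ZMod (ℓ * n)) := by
    push_cast; rw [ZMod.natCast_zmod_val]
  rw [e, ZMod.val_natCast]
  have hdm : n * (y.val / n) + y.val % n = y.val := Nat.div_add_mod y.val n
  have hbl : (y.val / n + j) % ℓ < ℓ := Nat.mod_lt _ hℓ
  have hdb : ℓ * ((y.val / n + j) / ℓ) + (y.val / n + j) % ℓ = y.val / n + j := Nat.div_add_mod _ ℓ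
  have e2 : y.val + j * n = (y.val % n + ((y.val / n + j) % ℓ) * n) + (ℓ * n) * ((y.val / n + j) / ℓ) := by
    have : y.val + j * n = y.val % n + (y.val / n + j) * n := by
      conv_lhs => rw [← hdm]
      ring
    rw [this]
    conv_lhs => rw [← hdb]
    ring
  have hlt : y.val % n + ((y.val / n + j) % ℓ) * n < ℓ * n := by
    have h1 : ((y.val / n + j) % ℓ + 1) * n ≤ ℓ * n := Nat.mul_le_mul_right n hbl
    have htn : y.val % n < n := Nat.mod_lt _ hn
    rw [Nat.add_mul, one_mul] at h1
    omega
  rw [e2, Nat.add_mul_mod_self_left, Nat.mod_eq_of_lt hlt]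

/-- **`⟨ℓ y⟩ = ℓ(⟨y⟩ mod n)`** at level `ℓn`. [folklore] -/
private theorem val_ell_mul [NeZero n] (hℓ : 0 < ℓ) (y : ZMod (ℓ * n)) : ((ℓ : ZMod (ℓ * n)) * y).val = ℓ * (y.val % n) := by
  haveI : NeZero (ℓ * n) := ⟨Nat.pos_iff_ne_zero.mp (Nat.mul_pos hℓ (NeZero.pos n))⟩
  have hn := NeZero.pos n
  have e : (ℓ : ZMod (ℓ * n)) * y = ((ℓ * y.val : ℕ) : ZMod (ℓ * n)) := by
    push_cast; rw [ZMod.natCast_zmod_val]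
  rw [e, ZMod.val_natCast]
  have hdm := Nat.div_add_mod y.val n
  have hml := Nat.mod_lt y.val hn
  have e2 : ℓ * y.val = ℓ * (y.val % n) + (ℓ * n) * (y.val / n) := by
    conv_lhs => rw [← hdm]
    ring
  have hlt : ℓ * (y.val % n) < ℓ * n := Nat.mul_lt_mul_of_pos_left hml hℓ
  rw [e2, Nat.add_mul_mod_self_left, Nat.mod_eq_of_lt hlt]

/-- The reduction `ℤ/ℓn → ℤ/n` on representatives. [folklore] -/
private theorem val_castHom_n [NeZero n] (hℓ : 0 < ℓ) (hnm : n ∣ ℓ * n) (y : ZMod (ℓ * n)) :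
    (ZMod.castHom hnm (ZMod n) y).val = y.val % n := by
  haveI : NeZero (ℓ * n) := ⟨Nat.pos_iff_ne_zero.mp (Nat.mul_pos hℓ (NeZero.pos n))⟩
  rw [ZMod.castHom_apply, ZMod.cast_eq_val, ZMod.val_natCast]

/-- `ℓ · (⟨w⟩/ℓ) = w` for `w` with representative `≡ 0 (mod ℓ)` (level `ℓn`). [folklore] -/
private theorem ell_mul_div' [NeZero n] (hℓ : 0 < ℓ) {w : ZMod (ℓ * n)} (hw : w.val % ℓ = 0) :
    (ℓ : ZMod (ℓ * n)) * ((w.val / ℓ : ℕ) : ZMod (ℓ * n)) = w := by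
  haveI : NeZero (ℓ * n) := ⟨Nat.pos_iff_ne_zero.mp (Nat.mul_pos hℓ (NeZero.pos n))⟩
  have h := Nat.div_add_mod w.val ℓ
  rw [hw, add_zero] at h
  calc (ℓ : ZMod (ℓ * n)) * ((w.val / ℓ : ℕ) : ZMod (ℓ * n)) = (((ℓ * (w.val / ℓ) : ℕ)) : ZMod (ℓ * n)) := by push_cast; ring
    _ = w := by rw [h, ZMod.natCast_zmod_val]

/-- Sums over `ℤ/ℓ` by representatives are sums over `range ℓ`. [folklore] -/
private theorem sum_zmod_val_eq_sum_range' [NeZero ℓ] (F : ℕ → ℕ) : ∑ x : ZMod ℓ, F x.val = ∑ j ∈ Finset.range ℓ, F j := by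
  obtain ⟨k, hk⟩ : ∃ k, ℓ = k + 1 := ⟨ℓ - 1, (Nat.succ_pred_eq_of_pos (NeZero.pos ℓ)).symm⟩
  subst hk
  exact Fin.sum_univ_eq_sum_range F (k + 1)

/-- `2 Σ_{x ∈ ℤ/ℓ} ⟨x⟩ = ℓ(ℓ − 1)`. [folklore] -/
private theorem two_mul_sum_zmod_val' [NeZero ℓ] : 2 * ∑ x : ZMod ℓ, x.val = ℓ * (ℓ - 1) := by
  have h := sum_zmod_val_eq_sum_range' (ℓ := ℓ) (fun j ↦ j)
  rw [h, mul_comm, Finset.sum_range_id_mul_two]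

/-- Translation invariance: `Σ_x F(⟨q + x⟩) = Σ_x F(⟨x⟩)` over `ℤ/ℓ`. [folklore] -/
private theorem sum_zmod_val_add' [NeZero ℓ] (F : ℕ → ℕ) (q : ZMod ℓ) :
    ∑ x : ZMod ℓ, F (q + x).val = ∑ x : ZMod ℓ, F x.val :=
  Equiv.sum_comp (Equiv.addLeft q) (fun x ↦ F x.val)

/-- Dilation invariance: `Σ_x F(⟨x r⟩) = Σ_x F(⟨x⟩)` over the field `ℤ/ℓ`, `r ≠ 0`. [folklore] -/
private theorem sum_zmod_val_mul' [Fact ℓ.Prime] (F : ℕ → ℕ) {r : ZMod ℓ} (hr : r ≠ 0) :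
    ∑ x : ZMod ℓ, F (x * r).val = ∑ x : ZMod ℓ, F x.val :=
  Equiv.sum_comp (Equiv.mulRight₀ r hr) (fun x ↦ F x.val)

/-- **`Σ_{j mod ℓ} ⟨y + j n⟩ = ℓ(⟨y⟩ mod n) + n Σ_{j mod ℓ} j`** at level `ℓn`. [folklore] -/
private theorem sum_val_add_mul_n [NeZero n] [NeZero ℓ] (y : ZMod (ℓ * n)) :
    ∑ x : ZMod ℓ, (y + (x.val : ZMod (ℓ * n)) * (n : ZMod (ℓ * n))).val = ℓ * (y.val % n) + n * ∑ x : ZMod ℓ, x.val := by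
  have hℓ := NeZero.pos ℓ
  have e : ∀ x : ZMod ℓ, (y + (x.val : ZMod (ℓ * n)) * (n : ZMod (ℓ * n))).val =
      y.val % n + (((y.val / n : ℕ) : ZMod ℓ) + x).val * n := by
    intro x
    rw [val_add_mul_n hℓ, ZMod.val_add, ZMod.val_natCast, Nat.mod_add_mod]
  have h := sum_zmod_val_add' (ℓ := ℓ) (fun j ↦ j) (((y.val / n : ℕ) : ZMod ℓ))
  simp only [e, Finset.sum_add_distrib, Finset.sum_const, Finset.card_univ, ZMod.card, smul_eq_mul, ← Finset.sum_mul, h]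
  ring

/-- The product of two residues not divisible by the prime `ℓ` is not divisible by `ℓ` (level `ℓn`). [folklore] -/
private theorem mul_mod_ne_zero' [NeZero n] (hℓ : ℓ.Prime) {u w : ZMod (ℓ * n)} (hu : u.val % ℓ ≠ 0) (hw : w.val % ℓ ≠ 0) :
    (u * w).val % ℓ ≠ 0 := by
  haveI : NeZero (ℓ * n) := ⟨Nat.pos_iff_ne_zero.mp (Nat.mul_pos hℓ.pos (NeZero.pos n))⟩
  rw [ZMod.val_mul, Nat.mod_mod_of_dvd _ ⟨n, rfl⟩]
  intro h
  rcases (Nat.Prime.dvd_mul hℓ).1 (Nat.dvd_of_mod_eq_zero h) with h' | h'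
  · exact hu (Nat.mod_eq_zero_of_dvd h')
  · exact hw (Nat.mod_eq_zero_of_dvd h')

/-- A product with a factor divisible by `ℓ` is divisible by `ℓ` (level `ℓn`). [folklore] -/
private theorem mul_mod_eq_zero' {u w : ZMod (ℓ * n)} (hw : w.val % ℓ = 0) : (u * w).val % ℓ = 0 := by
  rw [ZMod.val_mul, Nat.mod_mod_of_dvd _ ⟨n, rfl⟩]
  exact Nat.mod_eq_zero_of_dvd (Dvd.dvd.mul_left (Nat.dvd_of_mod_eq_zero hw) _)

/-- A unit of `ℤ/ℓn` is not divisible by `ℓ` (`ℓ ≥ 2`). [folklore] -/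
private theorem mod_ne_zero_of_isUnit' [NeZero n] (hℓ : 2 ≤ ℓ) {u : ZMod (ℓ * n)} (hu : IsUnit u) : u.val % ℓ ≠ 0 := by
  haveI : NeZero (ℓ * n) := ⟨Nat.pos_iff_ne_zero.mp (Nat.mul_pos (by omega) (NeZero.pos n))⟩
  obtain ⟨u, rfl⟩ := hu
  have hc := ZMod.val_coe_unit_coprime u
  intro h
  have h3 : ℓ ∣ (u : ZMod (ℓ * n)).val := Nat.dvd_of_mod_eq_zero h
  have : ℓ ∣ Nat.gcd (u : ZMod (ℓ * n)).val (ℓ * n) := Nat.dvd_gcd h3 ⟨n, rfl⟩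
  rw [hc] at this
  have := Nat.le_of_dvd one_pos this
  omega

/-- **A residue of `ℤ/ℓn` divisible by `ℓ` is `ℓ` times its quotient read at level `n`**: `⟨x⟩ = ℓ · ⟨ℓ⁻¹ x̄⟩` (`(ℓ, n) = 1`,
`x̄ = x mod n`). [folklore] -/
private theorem val_eq_ell_mul_val_inv [NeZero n] (hℓ : 0 < ℓ) (hcop : Nat.Coprime ℓ n) (hnm : n ∣ ℓ * n) {x : ZMod (ℓ * n)}
    (hx : x.val % ℓ = 0) : x.val = ℓ * ((ℓ : ZMod n)⁻¹ * ZMod.castHom hnm (ZMod n) x).val := by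
  haveI : NeZero (ℓ * n) := ⟨Nat.pos_iff_ne_zero.mp (Nat.mul_pos hℓ (NeZero.pos n))⟩
  set R := ZMod.castHom hnm (ZMod n)
  have hxlt := ZMod.val_lt x
  have hq : x.val / ℓ < n := by
    rw [Nat.div_lt_iff_lt_mul hℓ, Nat.mul_comm n ℓ]; exact hxlt
  have e1 : R x = (ℓ : ZMod n) * ((x.val / ℓ : ℕ) : ZMod n) := by
    conv_lhs => rw [← ell_mul_div' hℓ hx]
    rw [map_mul, map_natCast, map_natCast]
  have e2 : (ℓ : ZMod n)⁻¹ * R x = ((x.val / ℓ : ℕ) : ZMod n) := by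
    rw [e1, ← mul_assoc, mul_comm ((ℓ : ZMod n)⁻¹), ZMod.coe_mul_inv_eq_one ℓ hcop, one_mul]
  rw [e2, ZMod.val_natCast, Nat.mod_eq_of_lt hq]
  have h := Nat.div_add_mod x.val ℓ
  rw [hx, add_zero] at h
  exact h.symm

/-- `ℓ⁻¹ · x ≠ 0` for `x ≠ 0` in `ℤ/n` (`(ℓ, n) = 1`). [folklore] -/
private theorem inv_mul_ne_zero [NeZero n] (hcop : Nat.Coprime ℓ n) {x : ZMod n} (hx : x ≠ 0) : (ℓ : ZMod n)⁻¹ * x ≠ 0 := by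
  intro h
  have : (ℓ : ZMod n) * ((ℓ : ZMod n)⁻¹ * x) = 0 := by rw [h, mul_zero]
  rw [← mul_assoc, ZMod.coe_mul_inv_eq_one ℓ hcop, one_mul] at this
  exact hx this

/-- `⟨−x⟩ + ⟨x⟩ = n` for `x ≠ 0` in `ℤ/n`. [folklore] -/
private theorem val_neg_add_val [NeZero n] {x : ZMod n} (hx : x ≠ 0) : (-x).val + x.val = n := by
  rw [ZMod.neg_val, if_neg hx]
  have := ZMod.val_lt x
  omega

/-- **Transfer `ℓn → n` for a prime `ℓ` with `(ℓ, n) = 1` (Aoki's `τ_ℓ` at a prime dividing the level once).** Split a multiset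
over `ℤ/ℓn` into its members with representative prime to `ℓ` and not divisible by `n` (`s₁`), prime to `ℓ` and divisible by `n`
(`s₂`) and divisible by `ℓ` (`s₀`); if `s₁ + s₂ + s₀` is a Hodge multiset of level `ℓn`, then
`τ_ℓ = (s₁ mod n) + (−ℓ⁻¹·s₁ mod n) + (ℓ − 1)·((representatives of s₀)/ℓ, read mod n)` is a Hodge multiset of level `n`
(`ℓ⁻¹` the inverse of `ℓ` modulo `n`). The multiset form of `τ_d(a) = (φ(m)/φ(m′)) ∏_{p ∣ d/(m,a), p ∤ m/d} (1, −p⁻¹)(a′)`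
[Aoki1983, p. 28] at `d = ℓ ∥ m = ℓn` together with [Aoki1983, Prop. 2.2] (`α ∈ B_m ⟹ τ_d(α)` annihilated at level `m/d`),
proved here directly on the norm equations: for a unit `u` of `ℤ/ℓn` the elements `u(1 + jn)`, `j mod ℓ`, `j ≠ j₀`, are the
`ℓ − 1` units above `ū`; for `ℓ ∤ ⟨w⟩` the products `u(1 + jn)w` run through `uw + kn` minus the multiple of `ℓ` congruent to
`uw` mod `n`, which is `ℓ·⟨ℓ⁻¹ ū w̄⟩`; for `ℓ ∣ ⟨w⟩` all products equal `uw = ℓ·u(w/ℓ)`; add the `ℓ − 1` norm equations and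
divide by `ℓ`. [cite: Aoki1983, p. 28 (τ_d), Prop. 2.2 p. 29] [cite: Shioda1979PJA, §1 eq. (2)] -/
theorem isHodgeMultiset_transfer_single [NeZero n] (hℓ : ℓ.Prime) (hcop : Nat.Coprime ℓ n) (hnm : n ∣ ℓ * n)
    {s₁ s₂ s₀ : Multiset (ZMod (ℓ * n))}
    (h₁ : ∀ w ∈ s₁, w.val % ℓ ≠ 0 ∧ w.val % n ≠ 0) (h₂ : ∀ w ∈ s₂, w.val % ℓ ≠ 0 ∧ w.val % n = 0)
    (h₀ : ∀ w ∈ s₀, w.val % ℓ = 0) (hs : IsHodgeMultiset (s₁ + s₂ + s₀)) :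
    IsHodgeMultiset (s₁.map (ZMod.castHom hnm (ZMod n)) +
      s₁.map (fun w ↦ -((ℓ : ZMod n)⁻¹ * ZMod.castHom hnm (ZMod n) w)) +
      (ℓ - 1) • s₀.map fun w ↦ ZMod.castHom hnm (ZMod n) ((w.val / ℓ : ℕ) : ZMod (ℓ * n))) := by
  classical
  haveI := Fact.mk hℓ
  haveI : NeZero ℓ := ⟨hℓ.ne_zero⟩
  have hℓ0 := hℓ.pos
  have hℓ2 := hℓ.two_le
  haveI : NeZero (ℓ * n) := ⟨Nat.pos_iff_ne_zero.mp (Nat.mul_pos hℓ0 (NeZero.pos n))⟩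
  have hn0 := NeZero.pos n
  set R := ZMod.castHom hnm (ZMod n) with hR
  set L : ZMod n := (ℓ : ZMod n)⁻¹ with hL
  have hRn : R (n : ZMod (ℓ * n)) = 0 := by rw [map_natCast, ZMod.natCast_self]
  have hLℓ : (ℓ : ZMod n) * L = 1 := ZMod.coe_mul_inv_eq_one ℓ hcop
  obtain ⟨⟨hne, hsum⟩, hnorm⟩ := hs
  -- reduction of a member of `s₁` is non-zero
  have hR1 : ∀ w ∈ s₁, R w ≠ 0 := fun w hw h ↦ by
    have hv := congrArg ZMod.val h
    rw [val_castHom_n hℓ0, ZMod.val_zero] at hv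
    exact (h₁ w hw).2 hv
  -- reduction of a member of `s₂` is zero
  have hR2 : ∀ w ∈ s₂, R w = 0 := fun w hw ↦ by
    apply (ZMod.val_eq_zero _).mp
    rw [val_castHom_n hℓ0]
    exact (h₂ w hw).2
  -- `w/ℓ` read mod `n` is non-zero and `< n` for `w ∈ s₀`
  have hq0 : ∀ w ∈ s₀, w.val / ℓ < n ∧ w.val / ℓ ≠ 0 := fun w hw ↦ by
    have hlt := ZMod.val_lt w
    refine ⟨by rw [Nat.div_lt_iff_lt_mul hℓ0, Nat.mul_comm n ℓ]; exact hlt, fun h ↦ ?_⟩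
    have hd := Nat.div_add_mod w.val ℓ
    rw [h₀ w hw, add_zero, h, mul_zero] at hd
    exact hne w (Multiset.mem_add.mpr (Or.inr hw)) ((ZMod.val_eq_zero w).mp hd.symm)
  have hR0 : ∀ w ∈ s₀, (R ((w.val / ℓ : ℕ) : ZMod (ℓ * n))).val = w.val / ℓ := fun w hw ↦ by
    rw [map_natCast, ZMod.val_natCast, Nat.mod_eq_of_lt (hq0 w hw).1]
  refine ⟨⟨?_, ?_⟩, fun v ↦ ?_⟩
  · -- members are non-zero
    intro a ha
    rcases Multiset.mem_add.mp ha with ha | ha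
    · rcases Multiset.mem_add.mp ha with ha | ha
      · obtain ⟨w, hw, rfl⟩ := Multiset.mem_map.mp ha
        exact hR1 w hw
      · obtain ⟨w, hw, rfl⟩ := Multiset.mem_map.mp ha
        exact neg_ne_zero.mpr (inv_mul_ne_zero hcop (hR1 w hw))
    · obtain ⟨-, ha⟩ := Multiset.mem_nsmul.mp ha
      obtain ⟨w, hw, rfl⟩ := Multiset.mem_map.mp ha
      intro h
      have hv := congrArg ZMod.val h
      rw [hR0 w hw, ZMod.val_zero] at hv
      exact (hq0 w hw).2 hv
  · -- the sum is zero
    have e0 : ∀ w ∈ s₀, R w = (ℓ : ZMod n) * R ((w.val / ℓ : ℕ) : ZMod (ℓ * n)) := fun w hw ↦ by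
      conv_lhs => rw [← ell_mul_div' hℓ0 (h₀ w hw)]
      rw [map_mul, map_natCast]
    have hS : (s₁.map R).sum + (ℓ : ZMod n) * (s₀.map fun w ↦ R ((w.val / ℓ : ℕ) : ZMod (ℓ * n))).sum = 0 := by
      have h := congrArg R hsum
      rw [_root_.map_zero, map_multiset_sum, Multiset.map_add, Multiset.map_add, Multiset.sum_add, Multiset.sum_add] at h
      have h2 : (s₂.map R).sum = 0 := by
        rw [Multiset.sum_eq_zero]
        intro x hx
        obtain ⟨w, hw, rfl⟩ := Multiset.mem_map.mp hx
        exact hR2 w hw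
      have h3 : (s₀.map R).sum = (ℓ : ZMod n) * (s₀.map fun w ↦ R ((w.val / ℓ : ℕ) : ZMod (ℓ * n))).sum := by
        rw [← Multiset.sum_map_mul_left]
        exact congrArg Multiset.sum (Multiset.map_congr rfl e0)
      rw [h2, add_zero, h3] at h
      exact h
    rw [Multiset.sum_add, Multiset.sum_add, Multiset.sum_nsmul, Multiset.sum_map_neg, Multiset.sum_map_mul_left]
    set A := (s₁.map R).sum
    set B := (s₀.map fun w ↦ R ((w.val / ℓ : ℕ) : ZMod (ℓ * n))).sum
    have hcast : ((ℓ - 1 : ℕ) : ZMod n) = (ℓ : ZMod n) - 1 := by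
      rw [Nat.cast_sub (by omega), Nat.cast_one]
    rw [nsmul_eq_mul, hcast]
    linear_combination (1 - L) * hS + B * hLℓ
  · -- the norm equations
    obtain ⟨u, hu⟩ := ZMod.unitsMap_surjective hnm v
    have hvu : (v : ZMod n) = R u := by rw [← hu]; simp [ZMod.unitsMap_def, hR]
    have huℓ : (u : ZMod (ℓ * n)).val % ℓ ≠ 0 := mod_ne_zero_of_isUnit' hℓ2 u.isUnit
    -- the elements `e_j = 1 + j n`, `j mod ℓ`
    set E : ZMod ℓ → ZMod (ℓ * n) := fun x ↦ 1 + (x.val : ZMod (ℓ * n)) * (n : ZMod (ℓ * n)) with hE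
    have hRE : ∀ x, R (E x) = 1 := fun x ↦ by
      simp only [hE, _root_.map_add, _root_.map_one, _root_.map_mul, map_natCast, hRn, mul_zero, add_zero]
    -- the bad index `j₀`: `E j₀ ≡ 0 (mod ℓ)`
    have hnℓ : ((n : ℕ) : ZMod ℓ) ≠ 0 := by
      rw [Ne, ZMod.natCast_eq_zero_iff]
      intro h
      exact hℓ.one_lt.ne' (Nat.Coprime.eq_one_of_dvd hcop h)
    set j₀ : ZMod ℓ := -((n : ℕ) : ZMod ℓ)⁻¹ with hj₀
    have hEmod : ∀ x : ZMod ℓ, ((E x).val : ZMod ℓ) = 1 + x * ((n : ℕ) : ZMod ℓ) := fun x ↦ by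
      have e : E x = (((1 + x.val * n : ℕ)) : ZMod (ℓ * n)) := by rw [hE]; push_cast; ring
      rw [e, ZMod.val_natCast, ← ZMod.natCast_mod _ ℓ, Nat.mod_mul_right_mod, ZMod.natCast_mod]
      push_cast
      rw [ZMod.natCast_zmod_val]
    have hbad : (E j₀).val % ℓ = 0 := by
      apply Nat.mod_eq_zero_of_dvd
      rw [← ZMod.natCast_eq_zero_iff, hEmod, hj₀, neg_mul, inv_mul_cancel₀ hnℓ, add_neg_cancel]
    have hgood : ∀ x : ZMod ℓ, x ≠ j₀ → (E x).val % ℓ ≠ 0 := fun x hx h ↦ by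
      have h' : ((E x).val : ZMod ℓ) = 0 := by rw [ZMod.natCast_eq_zero_iff]; exact Nat.dvd_of_mod_eq_zero h
      rw [hEmod] at h'
      apply hx
      rw [hj₀]
      have : x * ((n : ℕ) : ZMod ℓ) = -1 := by linear_combination h'
      calc x = x * ((n : ℕ) : ZMod ℓ) * ((n : ℕ) : ZMod ℓ)⁻¹ := by rw [mul_assoc, mul_inv_cancel₀ hnℓ, mul_one]
        _ = _ := by rw [this]; ring
    -- for `j ≠ j₀`, `u·E j` is a unit and the norm equation holds
    have hunit : ∀ x : ZMod ℓ, x ≠ j₀ → IsUnit ((u : ZMod (ℓ * n)) * E x) := fun x hx ↦ by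
      refine u.isUnit.mul ?_
      have e : E x = (((1 + x.val * n : ℕ)) : ZMod (ℓ * n)) := by rw [hE]; push_cast; ring
      rw [e, ZMod.isUnit_iff_coprime]
      refine Nat.Coprime.mul_right ?_ ?_
      · rw [Nat.coprime_comm, Nat.Prime.coprime_iff_not_dvd hℓ]
        intro hd
        apply hgood x hx
        rw [e, ZMod.val_natCast]
        exact Nat.mod_eq_zero_of_dvd ((Nat.dvd_mod_iff ⟨n, rfl⟩).mpr hd)
      · simp
    have normeq : ∀ x : ZMod ℓ, x ≠ j₀ →
        2 * ((s₁.map fun w ↦ ((u : ZMod (ℓ * n)) * E x * w).val).sum +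
          (s₂.map fun w ↦ ((u : ZMod (ℓ * n)) * E x * w).val).sum +
          (s₀.map fun w ↦ ((u : ZMod (ℓ * n)) * E x * w).val).sum) =
        ℓ * n * (Multiset.card s₁ + Multiset.card s₂ + Multiset.card s₀) := by
      intro x hx
      have h := hnorm (hunit x hx).unit
      simp only [mNormSum, Multiset.map_add, Multiset.map_map, Function.comp_def, Multiset.sum_add, Multiset.card_add,
        IsUnit.unit_spec] at h
      exact h
    -- products with members prime to `ℓ`: `u E_j w = uw + (j ⟨uw⟩) n`
    have prod : ∀ w : ZMod (ℓ * n), ∀ x : ZMod ℓ, (u : ZMod (ℓ * n)) * E x * w =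
        (u : ZMod (ℓ * n)) * w +
          (((x * ((((u : ZMod (ℓ * n)) * w).val : ℕ) : ZMod ℓ)).val : ℕ) : ZMod (ℓ * n)) * (n : ZMod (ℓ * n)) := by
      intro w x
      rw [ZMod.val_mul, ZMod.val_natCast, natCast_mod_mul_n, Nat.cast_mul]
      simp only [hE]
      linear_combination (x.val : ZMod (ℓ * n)) * n_mul hℓ0 ((u : ZMod (ℓ * n)) * w)
    -- the full sum over `j mod ℓ` for a member prime to `ℓ`
    have full₁ : ∀ w : ZMod (ℓ * n), w.val % ℓ ≠ 0 →
        ∑ x : ZMod ℓ, ((u : ZMod (ℓ * n)) * E x * w).val =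
          ℓ * ((R ((u : ZMod (ℓ * n)) * w)).val) + n * ∑ x : ZMod ℓ, x.val := by
      intro w hw
      have hyℓ : ((u : ZMod (ℓ * n)) * w).val % ℓ ≠ 0 := mul_mod_ne_zero' hℓ huℓ hw
      have hr : ((((u : ZMod (ℓ * n)) * w).val : ℕ) : ZMod ℓ) ≠ 0 := by
        rw [Ne, ZMod.natCast_eq_zero_iff]
        exact fun h ↦ hyℓ (Nat.mod_eq_zero_of_dvd h)
      rw [val_castHom_n hℓ0]
      calc ∑ x : ZMod ℓ, ((u : ZMod (ℓ * n)) * E x * w).val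
          = ∑ x : ZMod ℓ, ((u : ZMod (ℓ * n)) * w +
              (((x * ((((u : ZMod (ℓ * n)) * w).val : ℕ) : ZMod ℓ)).val : ℕ) : ZMod (ℓ * n)) * (n : ZMod (ℓ * n))).val := by
            simp only [prod]
        _ = ∑ x : ZMod ℓ, ((u : ZMod (ℓ * n)) * w + ((x.val : ℕ) : ZMod (ℓ * n)) * (n : ZMod (ℓ * n))).val :=
            sum_zmod_val_mul' (fun k ↦ ((u : ZMod (ℓ * n)) * w + ((k : ℕ) : ZMod (ℓ * n)) * (n : ZMod (ℓ * n))).val) hr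
        _ = ℓ * (((u : ZMod (ℓ * n)) * w).val % n) + n * ∑ x : ZMod ℓ, x.val := sum_val_add_mul_n _
    -- the bad product for a member prime to `ℓ`: `ℓ · ⟨ℓ⁻¹ v w̄⟩`
    have bad₁ : ∀ w : ZMod (ℓ * n), ((u : ZMod (ℓ * n)) * E j₀ * w).val = ℓ * (L * ((v : ZMod n) * R w)).val := by
      intro w
      have hx : ((u : ZMod (ℓ * n)) * E j₀ * w).val % ℓ = 0 := by
        have e : (u : ZMod (ℓ * n)) * E j₀ * w = ((u : ZMod (ℓ * n)) * w) * E j₀ := by ring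
        rw [e]
        exact mul_mod_eq_zero' hbad
      rw [val_eq_ell_mul_val_inv hℓ0 hcop hnm hx, map_mul, map_mul, hRE, mul_one, ← hvu]
    -- products with members divisible by `ℓ`: all equal `uw = ℓ · u (w/ℓ)`
    have prod₀ : ∀ w ∈ s₀, ∀ x : ZMod ℓ, ((u : ZMod (ℓ * n)) * E x * w).val =
        ℓ * (R ((u : ZMod (ℓ * n)) * ((w.val / ℓ : ℕ) : ZMod (ℓ * n)))).val := by
      intro w hw x
      have hKw : (n : ZMod (ℓ * n)) * w = 0 := by rw [n_mul hℓ0 w, h₀ w hw, Nat.cast_zero, zero_mul]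
      have hw' := ell_mul_div' hℓ0 (h₀ w hw)
      rw [val_castHom_n hℓ0, ← val_ell_mul hℓ0]
      congr 1
      rw [hE]
      simp only
      linear_combination (u : ZMod (ℓ * n)) * (x.val : ZMod (ℓ * n)) * hKw - (u : ZMod (ℓ * n)) * hw'
    -- members of `s₂`: `⟨uw⟩ ≡ 0 (mod n)` and the bad product vanishes
    have R2u : ∀ w ∈ s₂, R ((u : ZMod (ℓ * n)) * w) = 0 := fun w hw ↦ by rw [map_mul, hR2 w hw, mul_zero]
    -- sum the `ℓ − 1` norm equations: split `Σ_{j mod ℓ}` as the bad term plus the rest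
    have split : ∀ F : ZMod ℓ → ℕ, ∑ x : ZMod ℓ, F x = F j₀ + ∑ x ∈ Finset.univ.erase j₀, F x := fun F ↦
      (Finset.add_sum_erase _ F (Finset.mem_univ j₀)).symm
    have hcardE : (Finset.univ.erase j₀ : Finset (ZMod ℓ)).card = ℓ - 1 := by
      rw [Finset.card_erase_of_mem (Finset.mem_univ _), Finset.card_univ, ZMod.card]
    -- total over `j ≠ j₀` of the three parts
    have tot : ∑ x ∈ Finset.univ.erase j₀,
        2 * ((s₁.map fun w ↦ ((u : ZMod (ℓ * n)) * E x * w).val).sum +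
          (s₂.map fun w ↦ ((u : ZMod (ℓ * n)) * E x * w).val).sum +
          (s₀.map fun w ↦ ((u : ZMod (ℓ * n)) * E x * w).val).sum) =
        (ℓ - 1) * (ℓ * n * (Multiset.card s₁ + Multiset.card s₂ + Multiset.card s₀)) := by
      rw [Finset.sum_congr rfl fun x hx ↦ normeq x (Finset.ne_of_mem_erase hx), Finset.sum_const, hcardE, smul_eq_mul]
    -- evaluate the sums over all `j` of each part, swapping the order of summation
    have swap : ∀ t : Multiset (ZMod (ℓ * n)), ∀ S : Finset (ZMod ℓ),
        ∑ x ∈ S, (t.map fun w ↦ ((u : ZMod (ℓ * n)) * E x * w).val).sum =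
          (t.map fun w ↦ ∑ x ∈ S, ((u : ZMod (ℓ * n)) * E x * w).val).sum := by
      intro t S
      rw [Finset.sum_eq_multiset_sum, Multiset.sum_map_sum_map]
      rfl
    have sum₁ : ∑ x : ZMod ℓ, (s₁.map fun w ↦ ((u : ZMod (ℓ * n)) * E x * w).val).sum =
        ℓ * (s₁.map fun w ↦ (R ((u : ZMod (ℓ * n)) * w)).val).sum + (n * ∑ x : ZMod ℓ, x.val) * Multiset.card s₁ := by
      rw [swap s₁ Finset.univ]
      have : (s₁.map fun w ↦ ∑ x : ZMod ℓ, ((u : ZMod (ℓ * n)) * E x * w).val) =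
          s₁.map fun w ↦ ℓ * (R ((u : ZMod (ℓ * n)) * w)).val + n * ∑ x : ZMod ℓ, x.val :=
        Multiset.map_congr rfl fun w hw ↦ full₁ w (h₁ w hw).1
      rw [this, Multiset.sum_map_add, Multiset.sum_map_mul_left, Multiset.map_const', Multiset.sum_replicate, smul_eq_mul,
        mul_comm (Multiset.card s₁)]
    have sum₂ : ∑ x : ZMod ℓ, (s₂.map fun w ↦ ((u : ZMod (ℓ * n)) * E x * w).val).sum =
        (n * ∑ x : ZMod ℓ, x.val) * Multiset.card s₂ := by
      rw [swap s₂ Finset.univ]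
      have : (s₂.map fun w ↦ ∑ x : ZMod ℓ, ((u : ZMod (ℓ * n)) * E x * w).val) =
          s₂.map fun _ ↦ n * ∑ x : ZMod ℓ, x.val :=
        Multiset.map_congr rfl fun w hw ↦ by rw [full₁ w (h₂ w hw).1, R2u w hw, ZMod.val_zero, mul_zero, zero_add]
      rw [this, Multiset.map_const', Multiset.sum_replicate, smul_eq_mul, mul_comm (Multiset.card s₂)]
    have sum₀ : ∀ S : Finset (ZMod ℓ), ∑ x ∈ S, (s₀.map fun w ↦ ((u : ZMod (ℓ * n)) * E x * w).val).sum =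
        S.card * (ℓ * (s₀.map fun w ↦ (R ((u : ZMod (ℓ * n)) * ((w.val / ℓ : ℕ) : ZMod (ℓ * n)))).val).sum) := by
      intro S
      rw [swap s₀ S]
      have : (s₀.map fun w ↦ ∑ x ∈ S, ((u : ZMod (ℓ * n)) * E x * w).val) =
          s₀.map fun w ↦ S.card * (ℓ * (R ((u : ZMod (ℓ * n)) * ((w.val / ℓ : ℕ) : ZMod (ℓ * n)))).val) :=
        Multiset.map_congr rfl fun w hw ↦ by
          rw [Finset.sum_congr rfl fun x _ ↦ prod₀ w hw x, Finset.sum_const, smul_eq_mul]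
      rw [this, Multiset.sum_map_mul_left, Multiset.sum_map_mul_left]
    have bad₁sum : (s₁.map fun w ↦ ((u : ZMod (ℓ * n)) * E j₀ * w).val).sum =
        ℓ * (s₁.map fun w ↦ (L * ((v : ZMod n) * R w)).val).sum := by
      rw [← Multiset.sum_map_mul_left]
      exact congrArg Multiset.sum (Multiset.map_congr rfl fun w _ ↦ bad₁ w)
    have bad₂sum : (s₂.map fun w ↦ ((u : ZMod (ℓ * n)) * E j₀ * w).val).sum = 0 := by
      rw [Multiset.sum_eq_zero]
      intro x hx
      obtain ⟨w, hw, rfl⟩ := Multiset.mem_map.mp hx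
      rw [bad₁ w, hR2 w hw, mul_zero, mul_zero, ZMod.val_zero, mul_zero]
    -- rewrite `tot` with everything evaluated
    have hS := two_mul_sum_zmod_val' (ℓ := ℓ)
    have key : ∑ x ∈ Finset.univ.erase j₀,
        2 * ((s₁.map fun w ↦ ((u : ZMod (ℓ * n)) * E x * w).val).sum +
          (s₂.map fun w ↦ ((u : ZMod (ℓ * n)) * E x * w).val).sum +
          (s₀.map fun w ↦ ((u : ZMod (ℓ * n)) * E x * w).val).sum) +
        2 * ((s₁.map fun w ↦ ((u : ZMod (ℓ * n)) * E j₀ * w).val).sum +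
          (s₂.map fun w ↦ ((u : ZMod (ℓ * n)) * E j₀ * w).val).sum +
          (s₀.map fun w ↦ ((u : ZMod (ℓ * n)) * E j₀ * w).val).sum) =
        2 * (∑ x : ZMod ℓ, (s₁.map fun w ↦ ((u : ZMod (ℓ * n)) * E x * w).val).sum +
          ∑ x : ZMod ℓ, (s₂.map fun w ↦ ((u : ZMod (ℓ * n)) * E x * w).val).sum +
          ∑ x : ZMod ℓ, (s₀.map fun w ↦ ((u : ZMod (ℓ * n)) * E x * w).val).sum) := by
      rw [split, split (fun x ↦ (s₂.map fun w ↦ ((u : ZMod (ℓ * n)) * E x * w).val).sum),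
        split (fun x ↦ (s₀.map fun w ↦ ((u : ZMod (ℓ * n)) * E x * w).val).sum)]
      simp only [Finset.mul_sum, Finset.sum_add_distrib, mul_add]
      ring
    rw [tot, sum₁, sum₂, sum₀ Finset.univ, bad₁sum, bad₂sum, Finset.card_univ, ZMod.card] at key
    have sum₀' := sum₀ {j₀}
    rw [Finset.sum_singleton, Finset.card_singleton, one_mul] at sum₀'
    rw [sum₀'] at key
    -- the norm equation of the transferred multiset at `v`
    simp only [mNormSum, Multiset.map_add, Multiset.map_nsmul, Multiset.map_map, Function.comp_def, Multiset.sum_add,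
      Multiset.sum_nsmul, smul_eq_mul, Multiset.card_add, Multiset.card_nsmul, Multiset.card_map]
    have tso : (s₁.map fun w ↦ ((v : ZMod n) * R w).val) = s₁.map fun w ↦ (R ((u : ZMod (ℓ * n)) * w)).val := by
      refine Multiset.map_congr rfl fun w _ ↦ ?_
      rw [hvu, ← map_mul]
    have tsn : (s₁.map fun w ↦ ((v : ZMod n) * -(L * R w)).val) = s₁.map fun w ↦ n - (L * ((v : ZMod n) * R w)).val := by
      refine Multiset.map_congr rfl fun w hw ↦ ?_
      have hne' : L * ((v : ZMod n) * R w) ≠ 0 :=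
        inv_mul_ne_zero hcop (fun h ↦ hR1 w hw ((Units.mul_right_eq_zero v).mp h))
      have e : (v : ZMod n) * -(L * R w) = -(L * ((v : ZMod n) * R w)) := by ring
      have h := val_neg_add_val hne'
      rw [e]
      omega
    have tse : (s₀.map fun w ↦ ((v : ZMod n) * R ((w.val / ℓ : ℕ) : ZMod (ℓ * n))).val) =
        s₀.map fun w ↦ (R ((u : ZMod (ℓ * n)) * ((w.val / ℓ : ℕ) : ZMod (ℓ * n)))).val := by
      refine Multiset.map_congr rfl fun w _ ↦ ?_
      rw [hvu, ← map_mul]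
    -- the sum of `n − ⟨L v w̄⟩` over `s₁`
    have hle : ∀ w ∈ s₁, (L * ((v : ZMod n) * R w)).val ≤ n := fun w _ ↦ (ZMod.val_lt _).le
    have tsn' : (s₁.map fun w ↦ n - (L * ((v : ZMod n) * R w)).val).sum + (s₁.map fun w ↦ (L * ((v : ZMod n) * R w)).val).sum =
        n * Multiset.card s₁ := by
      rw [← Multiset.sum_map_add]
      have : (s₁.map fun w ↦ n - (L * ((v : ZMod n) * R w)).val + (L * ((v : ZMod n) * R w)).val) = s₁.map fun _ ↦ n :=
        Multiset.map_congr rfl fun w hw ↦ Nat.sub_add_cancel (hle w hw)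
      rw [this, Multiset.map_const', Multiset.sum_replicate, smul_eq_mul, mul_comm]
    rw [tso, tsn, tse]
    -- now pure arithmetic: name the sums
    generalize (s₁.map fun w ↦ (R ((u : ZMod (ℓ * n)) * w)).val).sum = A at key
    generalize (s₁.map fun w ↦ (L * ((v : ZMod n) * R w)).val).sum = B at key tsn'
    generalize (s₁.map fun w ↦ n - (L * ((v : ZMod n) * R w)).val).sum = C at tsn'
    generalize (s₀.map fun w ↦ (R ((u : ZMod (ℓ * n)) * ((w.val / ℓ : ℕ) : ZMod (ℓ * n)))).val).sum = D at key
    generalize (∑ x : ZMod ℓ, x.val) = S at key hS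
    generalize Multiset.card s₁ = c₁ at key tsn'
    generalize Multiset.card s₂ = c₂ at key
    generalize Multiset.card s₀ = c₀ at key
    -- cast to `ℤ` and finish linearly after isolating the multiples of `ℓ`
    obtain ⟨k, hk⟩ : ∃ k, ℓ = k + 1 := ⟨ℓ - 1, by omega⟩
    subst hk
    simp only [Nat.add_sub_cancel] at key hS ⊢
    -- `key`: `k(k+1)n(c₁+c₂+c₀) + 2((k+1)B + (k+1)D) = 2((k+1)A + nS(c₁+c₂) + (k+1)²D)` with `2S = (k+1)k`; cancel `k + 1`
    have key2 : (k + 1) * (k * n * (c₁ + c₂ + c₀) + 2 * B + 2 * D) =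
        (k + 1) * (2 * A + n * k * (c₁ + c₂) + 2 * (k + 1) * D) := by
      zify at key hS ⊢
      linear_combination key + ((n : ℤ) * (c₁ + c₂)) * hS
    have hstar := Nat.eq_of_mul_eq_mul_left (Nat.succ_pos k) key2
    zify at hstar tsn' ⊢
    linear_combination (-1 : ℤ) * hstar + 2 * tsn'

end SingleTransfer

end FermatCharacter

end Literature.AlgebraicGeometry.HodgeTheory
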